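import Literature.AlgebraicGeometry.Motives.AbelianVarietyLatticeTensorIsogeny
import HarnessLib

/-!
# Finite direct sums of lattice tensors: `Y ⊗ (⊕_w M_w) = ⊕_w (Y ⊗ M_w)` (block-diagonal action `diag(m_w(g))_w`) and
# Mazur–Rubin–Silverberg Cor. 2.5 / Thm. 4.5 in full: `M_ℚ ≅ ⊕_w (M_w)_ℚ ⟹ Y ⊗_β M ⇄ ⊕_w (Y ⊗_β M_w)` by `G`-equivariant isogenies,
# with `dim B_H(Y ⊗ M) = Σ_w dim B_H(Y ⊗ M_w)`, `dim B_W(Y ⊗ M) = Σ_w dim B_W(Y ⊗ M_w)`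

The `n`-ary version of `Motives/AbelianVarietyLatticeTensorSumsProducts` §2 and `Motives/AbelianVarietyLatticeTensorDecomposition` §1.
Data: a finite index set `W`, lattice tensors `X_w = Y ⊗_β M_w` (bicones `b_w` over `(Y)_{i ∈ ι_w}`, matrix representations `m_w`, common
twist `β`, actions `ρ_w`), and a bicone `B` over the family `(X_w)_{w ∈ W}` with `Σ_w π_w ≫ ι_w = 𝟙` carrying the PRODUCT ACTION `ρ_B`
(injections equivariant, `ι_w ≫ ρ_B(g) = ρ_w(g) ≫ ι_w`).  Proved here (no definitions):

* §0 products of arbitrary `G`-abelian varieties over a finite bicone: the product action EXISTS (`exists_biconeAction`: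
  `ρ_B(g) = Σ_w π_w ρ_w(g) ι_w`); its blocks `ι_{w'} ρ_B(g) π_w = δ_{ww'} ρ_w(g)`; the trace on a finite bicone over ANY family
  `Tr(f | T_ℓ B.pt) = Σ_w Tr(ι_w f π_w | T_ℓ X_w)` (`trace_tateModuleMap_bicone_eq_sum`, the non-constant version of the tree's
  `trace_tateModuleMap_permPower_eq_sum`); hence **`χ_{⊕ X_w} = Σ_w χ_{X_w}`**, **`dim B_H(⊕_w X_w) = Σ_w dim B_H(X_w)`** and
  **`dim B_W(⊕_w X_w) = Σ_w dim B_W(X_w)`** over any field for arbitrary actions `ρ_w` (`dim_image_norm_bicone_eq_sum`,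
  `dim_isotypical_bicone_eq_sum`; Serre §2.1 Prop. 2 (i), Lange–Rodríguez Prop. 2.9.3);
* §1 THE SIGMA BICONE: a bicone over `(Y)_{(w,i) ∈ Σ_w ι_w}` on the vertex of `B` EXISTS (`exists_sigmaBicone`: `π_{(w,i)} = π_w ≫ π_i`,
  `ι_{(w,i)} = ι_i ≫ ι_w` along `e`), is total (`sigmaBicone_total`), computes corner blocks (`sigmaBicone_blocks`), and carries the product
  action of the lattice tensors as the lattice tensor of the BLOCK-DIAGONAL representation **`Matrix.blockDiagonal' (m_w(g))_w`** twisted by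
  `β` (`sigmaBicone_blocks_action`; the representation exists, `exists_blockDiagonalRep`): `Y ⊗_β (⊕_w M_w) = ⊕_w (Y ⊗_β M_w)`
  (MRS Thm. 1.8; "`(⊕_i J_i) ⊗_𝒪 V ≅ ⊕_i (J_i ⊗_𝒪 V)`");
* §2 **MRS Cor. 2.5 in full**: an integral intertwiner `P : M → ⊕_w M_w` (`P m(g) = diag(m_w(g)) P`) with quasi-inverse `Q`
  (`Q P = d · 1 = P Q`, `d ≠ 0` — `M_ℚ ≅ ⊕_w (M_w)_ℚ` as `ℚ[G]`-modules) gives **`G`-equivariant isogenies `Y ⊗_β M ⇄ B.pt` composing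
  to `[d]`** (`exists_equivariant_isogeny_pair_bicone`), the action-free `Y^ι ∼ B.pt`, and numerically, with no bicone `B` at all,
  **`tr m = Σ_w tr m_w`**, **`dim B_H(Y ⊗ M) = Σ_w dim B_H(Y ⊗ M_w)`**, **`dim B_W(Y ⊗ M) = Σ_w dim B_W(Y ⊗ M_w)`** (untwisted tensors,
  any field) — MRS Thm. 4.5 "`Res V ∼ ⊕_ρ I_ρ ⊗ V`" is the case `M = ℤ[G]`, `M_ρ = ℤ[G] ∩ e_ρ ℚ[G]` (Def. 4.3).

## References

* [MazurRubinSilverberg2007] B. Mazur, K. Rubin, A. Silverberg, *Twisting commutative algebraic groups*, J. Algebra 314 (2007)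
  419–438: Thm. 1.8, Lemma 2.4, Cor. 2.5 ("`I ⊗_ℤ ℚ ≅ ⊕_{i=1}^t (J_i ⊗_ℤ ℚ)` ⇒ `I ⊗_𝒪 V` is `k`-isogenous to `⊕_{i=1}^t (J_i ⊗_𝒪 V)`";
  proof: "`(⊕_i J_i) ⊗_𝒪 V ≅ ⊕_i (J_i ⊗_𝒪 V)`"), Def. 4.3 (`I_ρ`, `V_ρ := I_ρ ⊗ V`), Thm. 4.5 (`Res^L_k V ∼ ⊕_ρ V_ρ`), Prop. 4.2.
  Held: `paper:doi-10-1016-j-jalgebra-2007-02-052`, PDF pp. 5, 7, 10 read 2026-08-28.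
* [SerreLinearRepresentations1977] J.-P. Serre, *Linear Representations of Finite Groups*, GTM 42 (1977): §1.3 ("the direct sum of an
  arbitrary finite number of representations is defined similarly", PDF p. 12), §2.1 Prop. 2 (i), §2.6 Thm. 8 (canonical decomposition).
* [LangeRodriguez2022] H. Lange, R. E. Rodríguez, *Decomposition of Jacobians by Prym Varieties*, LNM 2310 (2022), §2.9.1 Prop. 2.9.3
  (PDF p. 46).
* [KaniRosen1989] E. Kani, M. Rosen, *Idempotent relations and factors of Jacobians*, Math. Ann. 284 (1989), §3 Thm. B.
* [MumfordAV1970] D. Mumford, *Abelian Varieties* (1970), §19 Thm. 3 (p. 176: `T_ℓ` additive), Thm. 4 (p. 180).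
-/

noncomputable section

open CategoryTheory CategoryTheory.Limits
open Literature.NumberTheory.DiophantineGeometry
open Literature.RepresentationTheory.FiniteGroups

universe u

namespace Literature.AlgebraicGeometry.Motives

namespace AbelianVariety

namespace LatticeTensor

variable {K : Type u} [Field K]

/-! ## §0 Product actions on a finite bicone over an arbitrary family: existence, trace, fixed and isotypical parts -/

section BiconeAction

variable {W : Type} [Fintype W] {X : W → AbelianVariety K} (B : Bicone X) {G : Type} [Group G]
  (ρw : ∀ w, G →* End (X w)) (ρB : G →* End B.pt)

/-- **The product action on a finite bicone exists**: for actions `ρ_w` on `X_w` and a bicone `B` over `(X_w)_w` with `Σ_w π_w ι_w = 𝟙`,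
`ρ_B(g) = Σ_w π_w ≫ ρ_w(g) ≫ ι_w` is an action of `G` on `B.pt` making every injection and projection equivariant.
[cite: SerreLinearRepresentations1977, §1.3 (PDF p. 12)] [cite: MumfordAV1970, §19 Thm. 3 (p. 176)] -/
theorem exists_biconeAction (hB : ∑ w, B.π w ≫ B.ι w = 𝟙 B.pt) :
    ∃ ρB : G →* End B.pt, (∀ g, End.asHom (ρB g) = ∑ w, B.π w ≫ End.asHom (ρw w g) ≫ B.ι w) ∧
      (∀ g w, B.ι w ≫ End.asHom (ρB g) = End.asHom (ρw w g) ≫ B.ι w) ∧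
      (∀ g w, End.asHom (ρB g) ≫ B.π w = B.π w ≫ End.asHom (ρw w g)) := by
  classical
  have hι : ∀ g w, B.ι w ≫ (∑ w', B.π w' ≫ End.asHom (ρw w' g) ≫ B.ι w') = End.asHom (ρw w g) ≫ B.ι w := by
    intro g w
    rw [Preadditive.comp_sum, Finset.sum_eq_single w]
    · rw [bicone_ι_π_self_assoc]
    · intro w' _ hw'
      rw [bicone_ι_π_ne_assoc B (Ne.symm hw'), zero_comp]
    · intro h
      exact absurd (Finset.mem_univ w) h
  have key : ∀ g h : G, (∑ w, B.π w ≫ End.asHom (ρw w h) ≫ B.ι w) ≫ (∑ w, B.π w ≫ End.asHom (ρw w g) ≫ B.ι w) =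
      ∑ w, B.π w ≫ End.asHom (ρw w (g * h)) ≫ B.ι w := by
    intro g h
    rw [Preadditive.sum_comp]
    refine Finset.sum_congr rfl fun w _ ↦ ?_
    rw [Category.assoc, Category.assoc, hι g w, asHom_map_mul_eq_comp (ρw w), Category.assoc]
  refine ⟨{ toFun := fun g ↦ End.of (∑ w, B.π w ≫ End.asHom (ρw w g) ≫ B.ι w)
            map_one' := ?_
            map_mul' := fun g h ↦ ?_ }, fun g ↦ rfl, fun g w ↦ hι g w, fun g w ↦ ?_⟩
  · change (∑ w, B.π w ≫ End.asHom (ρw w 1) ≫ B.ι w) = 𝟙 B.pt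
    rw [← hB]
    exact Finset.sum_congr rfl fun w _ ↦ by rw [asHom_map_one_eq_id (ρw w), Category.id_comp]
  · change (∑ w, B.π w ≫ End.asHom (ρw w (g * h)) ≫ B.ι w) =
      (∑ w, B.π w ≫ End.asHom (ρw w h) ≫ B.ι w) ≫ (∑ w, B.π w ≫ End.asHom (ρw w g) ≫ B.ι w)
    exact (key g h).symm
  · change (∑ w', B.π w' ≫ End.asHom (ρw w' g) ≫ B.ι w') ≫ B.π w = B.π w ≫ End.asHom (ρw w g)
    rw [Preadditive.sum_comp, Finset.sum_eq_single w]
    · rw [Category.assoc, Category.assoc, bicone_ι_π_self, Category.comp_id]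
    · intro w' _ hw'
      rw [Category.assoc, Category.assoc, bicone_ι_π_ne B hw', comp_zero, comp_zero]
    · intro h
      exact absurd (Finset.mem_univ w) h

omit [Fintype W] in
/-- **Diagonal blocks of a product action**: `ι_w ≫ ρ_B(g) ≫ π_w = ρ_w(g)` when the injections are equivariant.
[cite: SerreLinearRepresentations1977, §1.3 (PDF p. 12)] -/
theorem ι_comp_asHom_comp_π_self (hι : ∀ g w, B.ι w ≫ End.asHom (ρB g) = End.asHom (ρw w g) ≫ B.ι w) (g : G) (w : W) :
    B.ι w ≫ End.asHom (ρB g) ≫ B.π w = End.asHom (ρw w g) := by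
  rw [reassoc_of% (hι g w), bicone_ι_π_self, Category.comp_id]

omit [Fintype W] in
/-- **Off-diagonal blocks of a product action vanish**: `ι_{w'} ≫ ρ_B(g) ≫ π_w = 0` for `w' ≠ w` when the injections are equivariant.
[cite: SerreLinearRepresentations1977, §1.3 (PDF p. 12)] -/
theorem ι_comp_asHom_comp_π_ne (hι : ∀ g w, B.ι w ≫ End.asHom (ρB g) = End.asHom (ρw w g) ≫ B.ι w) (g : G) {w w' : W}
    (h : w' ≠ w) : B.ι w' ≫ End.asHom (ρB g) ≫ B.π w = 0 := by
  rw [reassoc_of% (hι g w'), bicone_ι_π_ne B h, comp_zero]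

/-- **The `ℓ`-adic trace over a finite bicone is the sum of the traces of the diagonal blocks**, for an ARBITRARY family `(X_w)`:
`Tr(f | T_ℓ B.pt) = Σ_w Tr(ι_w ≫ f ≫ π_w | T_ℓ X_w)` (`f = Σ_w π_w ι_w f`, additivity of `T_ℓ` and `Tr(CD) = Tr(DC)`; `ℓ` invertible in `K`).
[cite: MumfordAV1970, §19 Thm. 3 (p. 176) and Thm. 4 (p. 180)] -/
theorem trace_tateModuleMap_bicone_eq_sum (ℓ : ℕ) [Fact ℓ.Prime] (hB : ∑ w, B.π w ≫ B.ι w = 𝟙 B.pt) (hℓ : (ℓ : K) ≠ 0)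
    (f : B.pt ⟶ B.pt) :
    LinearMap.trace ℤ_[ℓ] (B.pt.tateModule ℓ) (tateModuleMap ℓ f) =
      ∑ w, LinearMap.trace ℤ_[ℓ] ((X w).tateModule ℓ) (tateModuleMap ℓ (B.ι w ≫ f ≫ B.π w)) := by
  haveI := B.pt.module_free_tateModule_holds ℓ hℓ
  haveI := module_finite_tateModule_of_cast_ne_zero B.pt ℓ hℓ
  haveI := fun w ↦ (X w).module_free_tateModule_holds ℓ hℓ
  haveI := fun w ↦ module_finite_tateModule_of_cast_ne_zero (X w) ℓ hℓ
  have hf : f = ∑ w, B.π w ≫ B.ι w ≫ f := by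
    conv_lhs => rw [← Category.id_comp f, ← hB, Preadditive.sum_comp]
    simp only [Category.assoc]
  conv_lhs => rw [hf, tateModuleMap_sum, map_sum]
  refine Finset.sum_congr rfl fun w _ ↦ ?_
  rw [tateModuleMap_comp, LinearMap.trace_comp_comm', ← tateModuleMap_comp, Category.assoc]

/-- **`χ_ℓ^{⊕ X_w}(g) = Σ_w χ_ℓ^{X_w}(g)`** for the product action on a finite bicone (injections equivariant, `ℓ` invertible in `K`).
[cite: SerreLinearRepresentations1977, §2.1 Prop. 2 (i) (PDF p. 15)] [cite: MumfordAV1970, §19 Thm. 3 (p. 176)] -/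
theorem trace_tateModuleMap_asHom_bicone_eq_sum (ℓ : ℕ) [Fact ℓ.Prime] (hB : ∑ w, B.π w ≫ B.ι w = 𝟙 B.pt)
    (hι : ∀ g w, B.ι w ≫ End.asHom (ρB g) = End.asHom (ρw w g) ≫ B.ι w) (hℓ : (ℓ : K) ≠ 0) (g : G) :
    LinearMap.trace ℤ_[ℓ] (B.pt.tateModule ℓ) (tateModuleMap ℓ (End.asHom (ρB g))) =
      ∑ w, LinearMap.trace ℤ_[ℓ] ((X w).tateModule ℓ) (tateModuleMap ℓ (End.asHom (ρw w g))) := by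
  rw [trace_tateModuleMap_bicone_eq_sum B ℓ hB hℓ]
  exact Finset.sum_congr rfl fun w _ ↦ by rw [ι_comp_asHom_comp_π_self B ρw ρB hι g w]

/-- **`dim B_H(⊕_w X_w) = Σ_w dim B_H(X_w)` over ANY field** for the product action of arbitrary actions `ρ_w` on a finite bicone
(`H` a finite subgroup, `B_H = Im Σ_h ρ(h)`): `|H| · 2 dim B_H = Σ_h χ_ℓ(h)` and additivity of `χ_ℓ`, for an auxiliary prime `ℓ`.
[cite: LangeRodriguez2022, §2.9.1 Prop. 2.9.3 (PDF p. 46)] [cite: KaniRosen1989, §3 Thm. B] [cite: MumfordAV1970, §19 Thm. 3 (p. 176)] -/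
theorem dim_image_norm_bicone_eq_sum {H : Subgroup G} [Fintype H] (hB : ∑ w, B.π w ≫ B.ι w = 𝟙 B.pt)
    (hι : ∀ g w, B.ι w ≫ End.asHom (ρB g) = End.asHom (ρw w g) ≫ B.ι w)
    {N : B.pt ⟶ B.pt} (hN : End.of N = ∑ h : H, ρB h) {Nw : ∀ w, X w ⟶ X w} (hNw : ∀ w, End.of (Nw w) = ∑ h : H, ρw w h) :
    (image N).dim = ∑ w, (image (Nw w)).dim := by
  obtain ⟨ℓ, hℓp, hℓ⟩ := exists_prime_natCast_ne_zero (K := K)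
  haveI : Fact ℓ.Prime := ⟨hℓp⟩
  have h := card_mul_two_mul_dim_image_norm_eq_sum_trace_tateModuleMap ℓ ρB hN hℓ
  have hw := fun w ↦ card_mul_two_mul_dim_image_norm_eq_sum_trace_tateModuleMap ℓ (ρw w) (hNw w) hℓ
  simp_rw [trace_tateModuleMap_asHom_bicone_eq_sum B ρw ρB ℓ hB hι hℓ] at h
  rw [Finset.sum_comm, Finset.sum_congr rfl fun w _ ↦ (hw w).symm, ← Nat.cast_sum, Nat.cast_inj, ← Finset.mul_sum,
    ← Finset.mul_sum] at h
  have h3 := Nat.eq_of_mul_eq_mul_left (Fintype.card_pos (α := H)) h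
  omega

variable [Fintype G] {a : ratCharIdempotents G → G → ℤ}
  (ha : ∀ e : ratCharIdempotents G,
    (Fintype.card G : ℚ) • (e : MonoidAlgebra ℚ G) = ∑ g, (a e g : ℚ) • MonoidAlgebra.of ℚ G g)
  {u : ratCharIdempotents G → (B.pt ⟶ B.pt)} (hu : ∀ e, End.of (u e) = ∑ g, a e g • ρB g)
  {uw : ratCharIdempotents G → ∀ w, (X w ⟶ X w)} (huw : ∀ e w, End.of (uw e w) = ∑ g, a e g • ρw w g)

include ha hu huw

/-- **`dim B_W(⊕_w X_w) = Σ_w dim B_W(X_w)` over ANY field** for every isotypical component `B_W = Im u_W`, `u_W = Σ_g c_W(g) ρ(g)`, of a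
product action of arbitrary actions on a finite bicone (injections equivariant).
[cite: LangeRodriguez2022, §2.9.1 Prop. 2.9.3 (PDF p. 46)] [cite: SerreLinearRepresentations1977, §2.1 Prop. 2 (i) and §2.6 Thm. 8] -/
theorem dim_isotypical_bicone_eq_sum (hB : ∑ w, B.π w ≫ B.ι w = 𝟙 B.pt)
    (hι : ∀ g w, B.ι w ≫ End.asHom (ρB g) = End.asHom (ρw w g) ≫ B.ι w) (e : ratCharIdempotents G) :
    (image (u e)).dim = ∑ w, (image (uw e w)).dim := by
  obtain ⟨ℓ, hℓp, hℓ⟩ := exists_prime_natCast_ne_zero (K := K)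
  haveI : Fact ℓ.Prime := ⟨hℓp⟩
  have h := card_mul_two_mul_dim_isotypical_eq_sum ℓ ρB ha hu hℓ e
  have hw := fun w ↦ card_mul_two_mul_dim_isotypical_eq_sum ℓ (ρw w) ha (huw · w) hℓ e
  simp_rw [trace_tateModuleMap_asHom_bicone_eq_sum B ρw ρB ℓ hB hι hℓ, Finset.mul_sum] at h
  rw [Finset.sum_comm, Finset.sum_congr rfl fun w _ ↦ (hw w).symm, ← Nat.cast_sum, Nat.cast_inj, ← Finset.mul_sum,
    ← Finset.mul_sum] at h
  have h3 := Nat.eq_of_mul_eq_mul_left (Fintype.card_pos (α := G)) h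
  omega

end BiconeAction

/-! ## §1 The sigma bicone: `Y ⊗_β (⊕_w M_w) = ⊕_w (Y ⊗_β M_w)` with the block-diagonal representation `diag(m_w)_w` -/

section SigmaBicone

variable {Y : AbelianVariety K} {W : Type} [Fintype W] [DecidableEq W] {ι : W → Type} [∀ w, Fintype (ι w)]
  [∀ w, DecidableEq (ι w)] (bw : ∀ w, Bicone (fun _ : ι w ↦ Y)) (B : Bicone (fun w ↦ (bw w).pt))

omit [Fintype W] [DecidableEq W] [∀ w, Fintype (ι w)] [∀ w, DecidableEq (ι w)] in
/-- **The sigma bicone exists**: for powers `X_w = Y^{ι_w}` (bicones `b_w`) and a bicone `B` over `(X_w)_w` there is a bicone `d` over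
`(Y)_{(w,i) ∈ Σ_w ι_w}` on the vertex of `B` (along `e : d.pt ≅ B.pt`, the identity) with **`π_{(w,i)} = e ≫ π_w ≫ π_i`,
`ι_{(w,i)} = ι_i ≫ ι_w ≫ e⁻¹`** — "`(⊕_i J_i) ⊗_𝒪 V ≅ ⊕_i (J_i ⊗_𝒪 V)`". [cite: MazurRubinSilverberg2007, Cor. 2.5 (proof) and Thm. 1.8]
[cite: SerreLinearRepresentations1977, §1.3 (PDF p. 12)] -/
theorem exists_sigmaBicone :
    ∃ (d : Bicone (fun _ : (Σ w, ι w) ↦ Y)) (e : d.pt ≅ B.pt),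
      (∀ p : Σ w, ι w, d.π p = e.hom ≫ B.π p.1 ≫ (bw p.1).π p.2) ∧
      (∀ p : Σ w, ι w, d.ι p = ((bw p.1).ι p.2 ≫ B.ι p.1) ≫ e.inv) := by
  classical
  refine ⟨{ pt := B.pt
            π := fun p ↦ B.π p.1 ≫ (bw p.1).π p.2
            ι := fun p ↦ (bw p.1).ι p.2 ≫ B.ι p.1
            ι_π := fun p q ↦ ?_ }, Iso.refl _, fun p ↦ ?_, fun p ↦ ?_⟩
  · obtain ⟨w, i⟩ := p
    obtain ⟨w', j⟩ := q
    by_cases hw : w = w'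
    · subst hw
      by_cases hij : i = j
      · subst hij
        simp
      · simp [hij, bicone_ι_π_ne (bw w) hij]
    · simp [hw, bicone_ι_π_ne_assoc B hw]
  · exact (Category.id_comp _).symm
  · exact (Category.comp_id _).symm

omit [DecidableEq W] [∀ w, DecidableEq (ι w)] in
/-- **The sigma bicone is total** when the `b_w` and `B` are: `Σ_{(w,i)} π_{(w,i)} ι_{(w,i)} = 𝟙`. [cite: MazurRubinSilverberg2007, Cor. 2.5 (proof)] -/
theorem sigmaBicone_total (hb : ∀ w, ∑ i, (bw w).π i ≫ (bw w).ι i = 𝟙 (bw w).pt) (hB : ∑ w, B.π w ≫ B.ι w = 𝟙 B.pt)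
    {d : Bicone (fun _ : (Σ w, ι w) ↦ Y)} {e : d.pt ≅ B.pt}
    (hπ : ∀ p : Σ w, ι w, d.π p = e.hom ≫ B.π p.1 ≫ (bw p.1).π p.2)
    (hι : ∀ p : Σ w, ι w, d.ι p = ((bw p.1).ι p.2 ≫ B.ι p.1) ≫ e.inv) :
    ∑ p, d.π p ≫ d.ι p = 𝟙 d.pt := by
  have h1 : ∀ w, ∑ i : ι w, d.π ⟨w, i⟩ ≫ d.ι ⟨w, i⟩ = e.hom ≫ (B.π w ≫ B.ι w) ≫ e.inv := by
    intro w
    have h : ∀ i : ι w, d.π ⟨w, i⟩ ≫ d.ι ⟨w, i⟩ = e.hom ≫ B.π w ≫ ((bw w).π i ≫ (bw w).ι i) ≫ B.ι w ≫ e.inv := fun i ↦ by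
      rw [hπ, hι]; simp only [Category.assoc]
    simp_rw [h, ← Preadditive.comp_sum, ← Preadditive.sum_comp, hb w, Category.id_comp, Category.assoc]
  rw [Fintype.sum_sigma]
  simp_rw [h1, ← Preadditive.comp_sum, ← Preadditive.sum_comp, hB, Category.id_comp, Iso.hom_inv_id]

omit [Fintype W] [DecidableEq W] [∀ w, Fintype (ι w)] [∀ w, DecidableEq (ι w)] in
/-- **Blocks on the sigma bicone**: if every corner `ι_{w'} ≫ F ≫ π_w` of `F : B.pt → B.pt` has scalar blocks
`ι_j (ι_{w'} F π_w) π_i = A_{w,w',ij} • φ`, then `e F e⁻¹` has the blocks **`ι_{(w',j)} ≫ e F e⁻¹ ≫ π_{(w,i)} = A_{w,w',ij} • φ`** with respect to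
the sigma bicone. [cite: MazurRubinSilverberg2007, Prop. 1.6 (i)] [cite: SerreLinearRepresentations1977, §1.3 (PDF p. 12)] -/
theorem sigmaBicone_blocks {d : Bicone (fun _ : (Σ w, ι w) ↦ Y)} {e : d.pt ≅ B.pt}
    (hπ : ∀ p : Σ w, ι w, d.π p = e.hom ≫ B.π p.1 ≫ (bw p.1).π p.2)
    (hι : ∀ p : Σ w, ι w, d.ι p = ((bw p.1).ι p.2 ≫ B.ι p.1) ≫ e.inv)
    {F : B.pt ⟶ B.pt} {A : ∀ w w' : W, Matrix (ι w) (ι w') ℤ} {φ : Y ⟶ Y}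
    (hF : ∀ (w w' : W) (i : ι w) (j : ι w'), (bw w').ι j ≫ (B.ι w' ≫ F ≫ B.π w) ≫ (bw w).π i = A w w' i j • φ)
    (p q : Σ w, ι w) :
    d.ι q ≫ (e.hom ≫ F ≫ e.inv) ≫ d.π p = A p.1 q.1 p.2 q.2 • φ := by
  rw [hι, hπ, ← hF p.1 q.1 p.2 q.2]
  simp only [Category.assoc, Iso.inv_hom_id_assoc]

variable {G : Type} [Group G] (m : ∀ w, G →* Matrix (ι w) (ι w) ℤ) (β : G →* End Y)
  (ρw : ∀ w, G →* End (bw w).pt) (ρB : G →* End B.pt)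

omit bw B in
/-- **The block-diagonal sum of integral matrix representations is a matrix representation** `g ↦ diag(m_w(g))_w` on
`ℤ^{Σ_w ι_w} = ⊕_w M_w` (Mathlib's `Matrix.blockDiagonal'`) — as an existence statement. [cite: SerreLinearRepresentations1977, §1.3 (PDF p. 12)] -/
theorem exists_blockDiagonalRep :
    ∃ mm : G →* Matrix (Σ w, ι w) (Σ w, ι w) ℤ, ∀ g, mm g = Matrix.blockDiagonal' fun w ↦ m w g :=
  ⟨{ toFun := fun g ↦ Matrix.blockDiagonal' fun w ↦ m w g
     map_one' := by simp only [map_one]; exact Matrix.blockDiagonal'_one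
     map_mul' := fun g h ↦ by simp only [map_mul]; exact Matrix.blockDiagonal'_mul _ _ }, fun _ ↦ rfl⟩

omit [Fintype W] in
/-- **`Y ⊗_β (⊕_w M_w) = ⊕_w (Y ⊗_β M_w)`: the product action of lattice tensors has block-diagonal blocks.**  For lattice actions `ρ_w` on
`X_w = Y ⊗_β M_w` (blocks `m_w(g)_{ij} • β(g)`) and a product action `ρ_B` on `B.pt` (injections equivariant), the action `ρ''`
transported to the sigma bicone along `e` has the blocks **`ι_q ≫ ρ''(g) ≫ π_p = diag(m_w(g))_{pq} • β(g)`** (`Matrix.blockDiagonal'`) — the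
hypothesis `hρ` of `Motives/AbelianVarietyLatticeTensor` for `(d, diag(m_w), β)`. [cite: MazurRubinSilverberg2007, Thm. 1.8 and Cor. 2.5 (proof)]
[cite: SerreLinearRepresentations1977, §1.3 (PDF p. 12)] -/
theorem sigmaBicone_blocks_action
    (hρw : ∀ (w : W) (g : G) (i j : ι w), (bw w).ι j ≫ End.asHom (ρw w g) ≫ (bw w).π i = m w g i j • End.asHom (β g))
    (hιB : ∀ g w, B.ι w ≫ End.asHom (ρB g) = End.asHom (ρw w g) ≫ B.ι w)
    {d : Bicone (fun _ : (Σ w, ι w) ↦ Y)} {e : d.pt ≅ B.pt}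
    (hπ : ∀ p : Σ w, ι w, d.π p = e.hom ≫ B.π p.1 ≫ (bw p.1).π p.2)
    (hι : ∀ p : Σ w, ι w, d.ι p = ((bw p.1).ι p.2 ≫ B.ι p.1) ≫ e.inv)
    {ρ'' : G →* End d.pt} (hρ'' : ∀ g, End.asHom (ρ'' g) = e.hom ≫ End.asHom (ρB g) ≫ e.inv) (g : G) (p q : Σ w, ι w) :
    d.ι q ≫ End.asHom (ρ'' g) ≫ d.π p = (Matrix.blockDiagonal' fun w ↦ m w g) p q • End.asHom (β g) := by
  rw [hρ'']
  refine sigmaBicone_blocks bw B hπ hι (F := End.asHom (ρB g))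
    (A := fun w w' ↦ Matrix.of fun i j ↦ (Matrix.blockDiagonal' fun w ↦ m w g) ⟨w, i⟩ ⟨w', j⟩) (fun w w' i j ↦ ?_) p q
  rw [Matrix.of_apply]
  by_cases hw : w' = w
  · subst hw
    rw [ι_comp_asHom_comp_π_self B ρw ρB hιB g w', Matrix.blockDiagonal'_apply_eq, hρw]
  · rw [ι_comp_asHom_comp_π_ne B ρw ρB hιB g hw, Matrix.blockDiagonal'_apply_ne _ _ _ (Ne.symm hw), zero_comp, comp_zero,
      zero_smul]

end SigmaBicone

/-! ## §2 MRS Cor. 2.5 in full: `M_ℚ ≅ ⊕_w (M_w)_ℚ ⟹ Y ⊗_β M ⇄ ⊕_w (Y ⊗_β M_w)` and the additivity of `tr`, `dim B_H`, `dim B_W` -/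

section Decomposition

variable {Y : AbelianVariety K} {κ : Type} [Fintype κ] [DecidableEq κ] (b : Bicone (fun _ : κ ↦ Y))
  {W : Type} [Fintype W] [DecidableEq W] {ι : W → Type} [∀ w, Fintype (ι w)] [∀ w, DecidableEq (ι w)]
  (bw : ∀ w, Bicone (fun _ : ι w ↦ Y)) (B : Bicone (fun w ↦ (bw w).pt))
  {G : Type} [Group G] (m : G →* Matrix κ κ ℤ) (mw : ∀ w, G →* Matrix (ι w) (ι w) ℤ) (β : G →* End Y)
  (ρ : G →* End b.pt) (ρw : ∀ w, G →* End (bw w).pt) (ρB : G →* End B.pt)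

/-- **MRS Cor. 2.5 (general finite decomposition), equivariantly.**  If `P : ℤ^κ → ℤ^{Σ_w ι_w}` intertwines `m` with `diag(m_w)` and has
a quasi-inverse `Q` (`Q P = d · 1 = P Q`, `d ≠ 0`), then for the product action `ρ_B` on a total bicone `B` of the lattice tensors
`Y ⊗_β M_w` there are **`G`-equivariant isogenies `F : Y ⊗_β M → B.pt`, `F' : B.pt → Y ⊗_β M`, `F F' = [d]`, `F' F = [d]`** —
"`I ⊗_ℤ ℚ ≅ ⊕_i (J_i ⊗_ℤ ℚ)` as `𝒪[G_k]`-modules ⇒ `I ⊗_𝒪 V` is `k`-isogenous to `⊕_i (J_i ⊗_𝒪 V)`"; with `M = ℤ[G]`, `M_ρ = ℤ[G] ∩ e_ρ ℚ[G]`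
this is `Res V ∼ ⊕_ρ V_ρ` (Thm. 4.5). [cite: MazurRubinSilverberg2007, Cor. 2.5, Lemma 2.4, Def. 4.3 and Thm. 4.5]
[cite: SerreLinearRepresentations1977, §1.3 and §2.6 Thm. 8] -/
theorem exists_equivariant_isogeny_pair_bicone (hb : ∑ j, b.π j ≫ b.ι j = 𝟙 b.pt)
    (hbw : ∀ w, ∑ i, (bw w).π i ≫ (bw w).ι i = 𝟙 (bw w).pt) (hB : ∑ w, B.π w ≫ B.ι w = 𝟙 B.pt)
    (hρ : ∀ (g : G) (i j : κ), b.ι j ≫ End.asHom (ρ g) ≫ b.π i = m g i j • End.asHom (β g))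
    (hρw : ∀ (w : W) (g : G) (i j : ι w), (bw w).ι j ≫ End.asHom (ρw w g) ≫ (bw w).π i = mw w g i j • End.asHom (β g))
    (hιB : ∀ g w, B.ι w ≫ End.asHom (ρB g) = End.asHom (ρw w g) ≫ B.ι w)
    {P : Matrix (Σ w, ι w) κ ℤ} {Q : Matrix κ (Σ w, ι w) ℤ} {d : ℤ}
    (hP : ∀ g : G, P * m g = (Matrix.blockDiagonal' fun w ↦ mw w g) * P)
    (hQP : Q * P = d • (1 : Matrix κ κ ℤ)) (hPQ : P * Q = d • (1 : Matrix (Σ w, ι w) (Σ w, ι w) ℤ)) (hd : d ≠ 0) :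
    ∃ (F : b.pt ⟶ B.pt) (F' : B.pt ⟶ b.pt), IsIsogeny F ∧ IsIsogeny F' ∧
      (∀ g : G, End.asHom (ρ g) ≫ F = F ≫ End.asHom (ρB g)) ∧ (∀ g : G, End.asHom (ρB g) ≫ F' = F' ≫ End.asHom (ρ g)) ∧
      F ≫ F' = d • 𝟙 b.pt ∧ F' ≫ F = d • 𝟙 B.pt := by
  obtain ⟨dd, e, hπ, hι⟩ := exists_sigmaBicone bw B
  have hdd := sigmaBicone_total bw B hbw hB hπ hι
  -- the transported action `e ρ_B e⁻¹` on the sigma bicone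
  let ρ'' : G →* End dd.pt := e.symm.conj.toMonoidHom.comp ρB
  have hρ'' : ∀ g, End.asHom (ρ'' g) = e.hom ≫ End.asHom (ρB g) ≫ e.inv := fun g ↦ by
    change e.symm.conj (ρB g) = _
    rw [Iso.conj_apply]
    rfl
  obtain ⟨mm, hmm⟩ := exists_blockDiagonalRep mw
  have hblk : ∀ (g : G) (p q : Σ w, ι w), dd.ι q ≫ End.asHom (ρ'' g) ≫ dd.π p = mm g p q • End.asHom (β g) := by
    intro g p q
    rw [hmm]
    exact sigmaBicone_blocks_action bw B mw β ρw ρB hρw hιB hπ hι hρ'' g p q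
  have hP' : ∀ g : G, P * m g = mm g * P := fun g ↦ by rw [hmm]; exact hP g
  obtain ⟨F, F', hF, hF', hFc, hF'c, hFF', hF'F⟩ :=
    exists_equivariant_isogeny_pair b dd m mm β ρ ρ'' hb hdd hρ hblk hP' hQP hPQ hd
  have hcomm : ∀ g, End.asHom (ρ'' g) ≫ e.hom = e.hom ≫ End.asHom (ρB g) := fun g ↦ by
    rw [hρ'']; simp only [Category.assoc, Iso.inv_hom_id, Category.comp_id]
  have hinv : ∀ g, End.asHom (ρB g) ≫ e.inv = e.inv ≫ End.asHom (ρ'' g) := fun g ↦ by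
    rw [hρ'', e.inv_hom_id_assoc]
  refine ⟨F ≫ e.hom, e.inv ≫ F', isIsogeny_comp hF (isIsogeny_hom_of_iso e), isIsogeny_comp (isIsogeny_hom_of_iso e.symm) hF',
    fun g ↦ ?_, fun g ↦ ?_, ?_, ?_⟩
  · rw [reassoc_of% (hFc g), hcomm g, Category.assoc]
  · rw [reassoc_of% (hinv g), hF'c g, Category.assoc]
  · rw [Category.assoc, e.hom_inv_id_assoc, hFF']
  · rw [Category.assoc, reassoc_of% hF'F, Preadditive.zsmul_comp, Category.id_comp, Preadditive.comp_zsmul, e.inv_hom_id]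

/-- **`Y^κ ∼ B.pt` (the vertex of any total bicone over the powers `Y^{ι_w}`) whenever integral `P ∈ M_{(Σ ι_w) × κ}(ℤ)`, `Q` with
`Q P = d · 1 = P Q`, `d ≠ 0` exist**: the action-free shadow. [cite: MazurRubinSilverberg2007, Lemma 2.4 and Cor. 2.5] -/
theorem isIsogenous_bicone_of_intertwines (hb : ∑ j, b.π j ≫ b.ι j = 𝟙 b.pt)
    (hbw : ∀ w, ∑ i, (bw w).π i ≫ (bw w).ι i = 𝟙 (bw w).pt) (hB : ∑ w, B.π w ≫ B.ι w = 𝟙 B.pt)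
    {P : Matrix (Σ w, ι w) κ ℤ} {Q : Matrix κ (Σ w, ι w) ℤ} {d : ℤ}
    (hQP : Q * P = d • (1 : Matrix κ κ ℤ)) (hPQ : P * Q = d • (1 : Matrix (Σ w, ι w) (Σ w, ι w) ℤ)) (hd : d ≠ 0) :
    IsIsogenous b.pt B.pt := by
  obtain ⟨dd, e, hπ, hι⟩ := exists_sigmaBicone bw B
  have hdd := sigmaBicone_total bw B hbw hB hπ hι
  obtain ⟨F, hF⟩ := isIsogenous_of_intertwines b dd hb hdd hQP hPQ hd
  exact ⟨F ≫ e.hom, isIsogeny_comp hF (isIsogeny_hom_of_iso e)⟩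

omit bw B in
/-- **`tr m(g) = Σ_w tr m_w(g)` when `M_ℚ ≅ ⊕_w (M_w)_ℚ`** (integral intertwiner with a quasi-inverse; `tr diag(A_w) = Σ_w tr A_w`).
[cite: SerreLinearRepresentations1977, §2.1 Prop. 2 (i) (PDF p. 15)] -/
theorem trace_eq_sum_trace_of_intertwines {P : Matrix (Σ w, ι w) κ ℤ} {Q : Matrix κ (Σ w, ι w) ℤ} {d : ℤ}
    (hP : ∀ g : G, P * m g = (Matrix.blockDiagonal' fun w ↦ mw w g) * P)
    (hQP : Q * P = d • (1 : Matrix κ κ ℤ)) (hPQ : P * Q = d • (1 : Matrix (Σ w, ι w) (Σ w, ι w) ℤ)) (hd : d ≠ 0) (g : G) :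
    (m g).trace = ∑ w, (mw w g).trace := by
  classical
  obtain ⟨mm, hmm⟩ := exists_blockDiagonalRep mw
  have hP' : ∀ g : G, P * m g = mm g * P := fun g ↦ by rw [hmm]; exact hP g
  rw [trace_eq_trace_of_intertwines m mm hP' hQP hPQ hd g, hmm, Matrix.trace_blockDiagonal']

omit B in
/-- **`dim B_H(Y ⊗ M) = Σ_w dim B_H(Y ⊗ M_w)` over ANY field when `M_ℚ ≅ ⊕_w (M_w)_ℚ`** (untwisted tensors, `H` a finite subgroup,
`B_H = Im Σ_h ρ(h)`; no bicone `B` needed): `|H| dim B_H(Y ⊗ M) = (Σ_h tr m(h)) dim Y` (prequel) and `tr m = Σ_w tr m_w`.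
[cite: MazurRubinSilverberg2007, Cor. 2.5 and Thm. 4.5] [cite: LangeRodriguez2022, §2.9.1 Prop. 2.9.3 (PDF p. 46)] [cite: KaniRosen1989, §3 Thm. B] -/
theorem dim_image_norm_eq_sum_of_intertwines {H : Subgroup G} [Fintype H] (hb : ∑ j, b.π j ≫ b.ι j = 𝟙 b.pt)
    (hbw : ∀ w, ∑ i, (bw w).π i ≫ (bw w).ι i = 𝟙 (bw w).pt)
    (hρ₁ : ∀ (g : G) (i j : κ), b.ι j ≫ End.asHom (ρ g) ≫ b.π i = m g i j • 𝟙 Y)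
    (hρw₁ : ∀ (w : W) (g : G) (i j : ι w), (bw w).ι j ≫ End.asHom (ρw w g) ≫ (bw w).π i = mw w g i j • 𝟙 Y)
    {P : Matrix (Σ w, ι w) κ ℤ} {Q : Matrix κ (Σ w, ι w) ℤ} {d : ℤ}
    (hP : ∀ g : G, P * m g = (Matrix.blockDiagonal' fun w ↦ mw w g) * P)
    (hQP : Q * P = d • (1 : Matrix κ κ ℤ)) (hPQ : P * Q = d • (1 : Matrix (Σ w, ι w) (Σ w, ι w) ℤ)) (hd : d ≠ 0)
    {N : b.pt ⟶ b.pt} (hN : End.of N = ∑ h : H, ρ h) {Nw : ∀ w, (bw w).pt ⟶ (bw w).pt}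
    (hNw : ∀ w, End.of (Nw w) = ∑ h : H, ρw w h) :
    (image N).dim = ∑ w, (image (Nw w)).dim := by
  classical
  have h := card_mul_dim_image_norm_eq b m ρ hb hρ₁ hN
  have hw := fun w ↦ card_mul_dim_image_norm_eq (bw w) (mw w) (ρw w) (hbw w) (hρw₁ w) (hNw w)
  simp_rw [trace_eq_sum_trace_of_intertwines m mw hP hQP hPQ hd] at h
  rw [Finset.sum_comm, Finset.sum_mul, Finset.sum_congr rfl fun w _ ↦ (hw w).symm, ← Nat.cast_sum, Nat.cast_inj,
    ← Finset.mul_sum] at h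
  exact Nat.eq_of_mul_eq_mul_left (Fintype.card_pos (α := H)) h

variable [Fintype G] {a : ratCharIdempotents G → G → ℤ}
  (ha : ∀ e : ratCharIdempotents G,
    (Fintype.card G : ℚ) • (e : MonoidAlgebra ℚ G) = ∑ g, (a e g : ℚ) • MonoidAlgebra.of ℚ G g)
  {u : ratCharIdempotents G → (b.pt ⟶ b.pt)} (hu : ∀ e, End.of (u e) = ∑ g, a e g • ρ g)
  {uw : ratCharIdempotents G → ∀ w, ((bw w).pt ⟶ (bw w).pt)} (huw : ∀ e w, End.of (uw e w) = ∑ g, a e g • ρw w g)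

include ha hu huw

omit B in
/-- **`dim B_W(Y ⊗ M) = Σ_w dim B_W(Y ⊗ M_w)` over ANY field for every isotypical component when `M_ℚ ≅ ⊕_w (M_w)_ℚ`** (untwisted
tensors): `|G| dim B_W(Y ⊗ M) = (Σ_g c_W(g) tr m(g)) dim Y` and `tr m = Σ_w tr m_w` — "`Res V ∼ ⊕_ρ I_ρ ⊗ V`" componentwise.
[cite: MazurRubinSilverberg2007, Cor. 2.5, Def. 4.3 and Thm. 4.5] [cite: LangeRodriguez2022, §2.9.1 Prop. 2.9.3 (PDF p. 46)]
[cite: SerreLinearRepresentations1977, §2.6 Thm. 8] -/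
theorem dim_isotypical_eq_sum_of_intertwines (hb : ∑ j, b.π j ≫ b.ι j = 𝟙 b.pt)
    (hbw : ∀ w, ∑ i, (bw w).π i ≫ (bw w).ι i = 𝟙 (bw w).pt)
    (hρ₁ : ∀ (g : G) (i j : κ), b.ι j ≫ End.asHom (ρ g) ≫ b.π i = m g i j • 𝟙 Y)
    (hρw₁ : ∀ (w : W) (g : G) (i j : ι w), (bw w).ι j ≫ End.asHom (ρw w g) ≫ (bw w).π i = mw w g i j • 𝟙 Y)
    {P : Matrix (Σ w, ι w) κ ℤ} {Q : Matrix κ (Σ w, ι w) ℤ} {d : ℤ}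
    (hP : ∀ g : G, P * m g = (Matrix.blockDiagonal' fun w ↦ mw w g) * P)
    (hQP : Q * P = d • (1 : Matrix κ κ ℤ)) (hPQ : P * Q = d • (1 : Matrix (Σ w, ι w) (Σ w, ι w) ℤ)) (hd : d ≠ 0)
    (e : ratCharIdempotents G) :
    (image (u e)).dim = ∑ w, (image (uw e w)).dim := by
  classical
  have h := card_mul_dim_isotypical_eq b m ρ ha hu hb hρ₁ e
  have hw := fun w ↦ card_mul_dim_isotypical_eq (bw w) (mw w) (ρw w) ha (huw · w) (hbw w) (hρw₁ w) e
  simp_rw [trace_eq_sum_trace_of_intertwines m mw hP hQP hPQ hd, Finset.mul_sum] at h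
  rw [Finset.sum_comm, Finset.sum_mul, Finset.sum_congr rfl fun w _ ↦ (hw w).symm, ← Nat.cast_sum, Nat.cast_inj,
    ← Finset.mul_sum] at h
  exact Nat.eq_of_mul_eq_mul_left (Fintype.card_pos (α := G)) h

end Decomposition

end LatticeTensor

end AbelianVariety

end Literature.AlgebraicGeometry.Motives
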